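import Mathlib.Analysis.Calculus.Darboux
import Mathlib.Analysis.Calculus.Deriv.Slope
import Literature.MathematicalPhysics.QuantumLattice.DWaveSourceProofs
import Literature.MathematicalPhysics.QuantumLattice.GroundStateSourceBounds
import Literature.MathematicalPhysics.QuantumLattice.HubbardModelGrandCanonicalProofs
import Literature.MathematicalPhysics.QuantumLattice.HubbardModelParticleHoleProofs
import Literature.MathematicalPhysics.QuantumLattice.HubbardHubbardModelEtaPairingProofs
import Literature.MathematicalPhysics.QuantumLattice.HubbardAtomicLimit
import Literature.MathematicalPhysics.QuantumLattice.PairFieldMomentum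
import HarnessLib

/-!
# The grand-canonical ground state of the Hubbard model: density–chemical-potential inequalities,
# a priori bounds, and Griffiths' lemma for the thermodynamic limit of the density

Family `hubbard` / trunk T-QLATTICE; elementary companions of `GroundStateSourceBounds.lean` and
`DWaveSourceProofs.lean`, written for the density clause of crux `WcbcsBcsConstruction` (route
`HubbardSuperconductivity/WeakCouplingBCS`, line `lro-seed-kink-bridge`, stub `stub_densityWindow`): the
grand-canonical tracial ground-state density `n_L(U,μ) = Re ω₀[hubbardTorusWith 2 L 1 U μ](N)/L²` should tend to a
prescribed `1 - δ` for a suitable `μ`. That clause needs the thermodynamic limit of the ground-state energy density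
of the 2D Hubbard torus and the absence of first-order density jumps at weak coupling — neither is known (nor in the
tree). This file proves what IS elementary, for the grand-canonical Hubbard Hamiltonian
`hamiltonianWith G t U μ = H(t,U) - μN` on ANY finite graph and for the tori `hubbardTorusWith 2 L t U μ`, with
`E(μ) = Matrix.groundEnergy (hamiltonianWith G t U μ)` and `ω_μ = Matrix.groundStateFunctional (hamiltonianWith G t U μ)`:

* `§ Loewner`: for Hermitian matrices, `A ≤ B ⇒ E₀(A) ≤ E₀(B)` and `B - A ≤ c ⇒ E₀(B) ≤ E₀(A) + c` (the tracial
  ground state of one is a trial state for the other; `Matrix.groundEnergy_le_groundStateFunctional_re`);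
* `§ GrandCanonical`: the supergradient (Griffiths–Hellmann–Feynman) inequality
  `(μ' - μ) Re ω_μ(N) ≤ E(μ) - E(μ')` (`sub_mul_gcNumber_le`, the case `K = H(t,U)`, `O = N` of
  `sub_mul_re_groundStateFunctional_le`), monotonicity of `μ ↦ Re ω_μ(N)` (`gcNumber_mono`), the slope sandwich
  `(E(μ-ε) - E(μ))/ε ≤ Re ω_μ(N) ≤ (E(μ) - E(μ+ε))/ε` (`gcNumber_mem_Icc_slope`); the operator bounds
  `0 ≤ N ≤ 2|Λ|`, `0 ≤ Σ_x n_{x↑}n_{x↓} ≤ |Λ|` (diagonal in the occupation basis, `HubbardAtomicLimit`), hence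
  `0 ≤ Re ω_μ(N) ≤ 2|Λ|` (`gcNumber_mem_Icc`), `μ ↦ E(μ)` non-increasing, `2|Λ|`-Lipschitz and concave
  (`groundEnergy_sub_mem_Icc_of_le`, `concaveOn_groundEnergy_hamiltonianWith`), and the interaction sandwich
  `E(t,U,μ) ≤ E(t,U',μ) ≤ E(t,U,μ) + (U' - U)|Λ|` for `U ≤ U'` (`groundEnergy_hamiltonianWith_mono_U`,
  `groundEnergy_hamiltonianWith_le_add`);
* `§ Griffiths`: Griffiths' lemma in sequence form (`tendsto_of_slope_sandwich`: a subgradient sandwich plus pointwise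
  convergence near `x` to a function differentiable at `x` forces the subgradients to converge to the derivative) and
  its application to the torus density: `tendsto_gcDensity_of_hasDerivAt` — IF `E₀(hubbardTorusWith 2 (L+1) t U μ')/(L+1)²
  → e(μ')` for `μ'` near `μ` and `e` is differentiable at `μ`, THEN `n_{L+1}(U,μ) → -e'(μ)`;
  `exists_tendsto_gcDensity_of_regularWindow` — a jump-free density window (`e` differentiable on `[μ₁,μ₂]`, end
  densities bracketing `[1-b, 1-a]`) yields, for EVERY `δ ∈ [a,b]`, a `μ` with `n_{L+1}(U,μ) → 1 - δ` (Darboux +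
  Griffiths); `densityClause_of_regularWindows` — the crux's density clause in its registered form
  (`∃ δ ∈ [a,b] ∃ U₁ ∀ U ∈ (0,U₁) ∃ μ …`) from that hypothesis assumed uniformly in `U ∈ (0,U₁)`;
* `§ Torus`: the torus forms in the normalisation of the crux (`|Λ| = L²`): density per site in `[0,2]`,
  `2L²`-Lipschitz bound and concavity in `μ`, `0 ≤ E(t,U,μ) - E(t,0,μ) ≤ U L²`.

Sources: R. B. Griffiths, J. Math. Phys. 5 (1964) 1215 (Griffiths' lemma); T. Koma, H. Tasaki, J. Stat. Phys. 76 (1994)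
745, §1 (sourced ground-state energies, their one-sided derivatives and order parameters); D. Ruelle, *Statistical
Mechanics: Rigorous Results* (1969) (convexity and Lipschitz bounds of thermodynamic functions). Everything here is
PROVED; no definition and no named fact is introduced. NOT here: the thermodynamic limit itself (for `d = 2` tori it is
not in the tree; the 1D canonical ring is `HubbardModelThermodynamicLimitProofs`), and any statement about the absence of
density jumps.
-/

noncomputable section

namespace Literature.MathematicalPhysics.QuantumLattice

open Matrix Filter Literature.Probability.LatticeModels
open scoped Matrix.Norms.L2Operator ComplexOrder _root_.Topology

/-! ### Two Loewner-order facts about the ground energy -/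

section Loewner

variable {n : Type*} [Fintype n] [DecidableEq n] [Nonempty n]

/-- **Loewner monotonicity of the ground energy**: `A ≤ B ⇒ E₀(A) ≤ E₀(B)` for Hermitian `A, B`
(the tracial ground state of `B` is a trial state for `A`, and `ω_B(B - A) ≥ 0`). [folklore] -/
theorem groundEnergy_mono_of_posSemidef_sub {A B : Matrix n n ℂ} (hA : A.IsHermitian)
    (hB : B.IsHermitian) (hAB : (B - A).PosSemidef) : A.groundEnergy ≤ B.groundEnergy := by
  have h1 := groundEnergy_le_groundStateFunctional_re hB hA
  have h2 := groundStateFunctional_nonneg_of_posSemidef B hAB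
  rw [map_sub, groundStateFunctional_hamiltonian hB] at h2
  obtain ⟨hre, -⟩ := Complex.nonneg_iff.mp h2
  simp only [Complex.sub_re, Complex.ofReal_re] at hre
  linarith

/-- **The ground energy moves by at most `c` under a perturbation bounded above by `c`**:
`B - A ≤ c ⇒ E₀(B) ≤ E₀(A) + c` for Hermitian `A, B` (the tracial ground state of `A` is a trial
state for `B`). [folklore] -/
theorem groundEnergy_le_add_of_sub_le_smul {A B : Matrix n n ℂ} (hA : A.IsHermitian)
    (hB : B.IsHermitian) {c : ℝ} (hc : ((c : ℂ) • (1 : Matrix n n ℂ) - (B - A)).PosSemidef) :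
    B.groundEnergy ≤ A.groundEnergy + c := by
  have h1 := groundEnergy_le_groundStateFunctional_re hA hB
  have h2 := groundStateFunctional_nonneg_of_posSemidef A hc
  rw [map_sub, map_sub, map_smul, groundStateFunctional_one hA,
    groundStateFunctional_hamiltonian hA] at h2
  obtain ⟨hre, -⟩ := Complex.nonneg_iff.mp h2
  simp only [Complex.sub_re, Complex.ofReal_re, smul_eq_mul, mul_one] at hre
  linarith

end Loewner

/-! ### The grand-canonical Hubbard Hamiltonian on a finite graph: density and energy in `μ` and `U` -/

section GrandCanonical

variable {Λ : Type*} [LinearOrder Λ] [Fintype Λ] (G : SimpleGraph Λ) [DecidableRel G.Adj]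

/-- **Supergradient (Griffiths / Hellmann–Feynman) inequality for the grand-canonical density**:
with `E(μ) = E₀(H(t,U) - μN)` and `ω_μ` the tracial ground state of `H(t,U) - μN`,
`(μ' - μ) · Re ω_μ(N) ≤ E(μ) - E(μ')` for all real `μ, μ'` — the ground state at `μ` is a trial
state at `μ'`. This is the finite-volume content of "`n = -∂E/∂μ`". [cite: KomaTasaki1994, §1] -/
theorem sub_mul_gcNumber_le (t U μ μ' : ℝ) :
    (μ' - μ) * ((hamiltonianWith G t U μ).groundStateFunctional totalNumber).re ≤
      (hamiltonianWith G t U μ).groundEnergy - (hamiltonianWith G t U μ').groundEnergy :=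
  sub_mul_re_groundStateFunctional_le (LiebThm1.hamiltonian_isHermitian G t U)
    totalNumber_isHermitian μ μ'

/-- **Monotonicity of the grand-canonical density in the chemical potential**:
`μ ≤ μ' ⇒ Re ω_μ(N) ≤ Re ω_{μ'}(N)` (concavity of `μ ↦ E(μ)`). [cite: KomaTasaki1994, §1] -/
theorem gcNumber_mono (t U : ℝ) {μ μ' : ℝ} (h : μ ≤ μ') :
    ((hamiltonianWith G t U μ).groundStateFunctional totalNumber).re ≤
      ((hamiltonianWith G t U μ').groundStateFunctional totalNumber).re :=
  re_groundStateFunctional_source_mono (LiebThm1.hamiltonian_isHermitian G t U)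
    totalNumber_isHermitian h

/-- **The Griffiths sandwich** at finite volume: for `ε > 0`,
`(E(μ-ε) - E(μ))/ε ≤ Re ω_μ(N) ≤ (E(μ) - E(μ+ε))/ε`. [cite: KomaTasaki1994, §1] -/
theorem gcNumber_mem_Icc_slope (t U μ : ℝ) {ε : ℝ} (hε : 0 < ε) :
    ((hamiltonianWith G t U μ).groundStateFunctional totalNumber).re ∈
      Set.Icc (((hamiltonianWith G t U (μ - ε)).groundEnergy -
          (hamiltonianWith G t U μ).groundEnergy) / ε)
        (((hamiltonianWith G t U μ).groundEnergy -
          (hamiltonianWith G t U (μ + ε)).groundEnergy) / ε) := by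
  have h1 := sub_mul_gcNumber_le G t U μ (μ - ε)
  have h2 := sub_mul_gcNumber_le G t U μ (μ + ε)
  rw [sub_sub_cancel_left, neg_mul] at h1
  rw [add_sub_cancel_left] at h2
  constructor
  · rw [div_le_iff₀ hε, mul_comm]
    linarith
  · rw [le_div_iff₀ hε, mul_comm]
    exact h2

/-- The total particle number is a positive operator. [folklore] -/
theorem posSemidef_totalNumber :
    (totalNumber : Matrix (Finset (Orb Λ)) (Finset (Orb Λ)) ℂ).PosSemidef := by
  rw [totalNumber_eq_diagonal_card, posSemidef_diagonal_iff]
  exact fun s => Nat.cast_nonneg _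

/-- `N ≤ 2|Λ|` as operators (at most two electrons per site). [folklore] -/
theorem posSemidef_two_mul_card_sub_totalNumber :
    (((2 * Fintype.card Λ : ℕ) : ℂ) • (1 : Matrix (Finset (Orb Λ)) (Finset (Orb Λ)) ℂ) -
      totalNumber).PosSemidef := by
  rw [totalNumber_eq_diagonal_card, smul_one_eq_diagonal, diagonal_sub, posSemidef_diagonal_iff]
  intro s
  have h : s.card ≤ 2 * Fintype.card Λ := by
    rw [← card_orb]
    exact Finset.card_le_univ s
  exact sub_nonneg.2 (Nat.mono_cast h)

/-- **A priori bounds on the grand-canonical particle number**: `0 ≤ Re ω_μ(N) ≤ 2|Λ|`. [folklore] -/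
theorem gcNumber_mem_Icc (t U μ : ℝ) :
    ((hamiltonianWith G t U μ).groundStateFunctional totalNumber).re ∈
      Set.Icc (0 : ℝ) (2 * Fintype.card Λ) := by
  constructor
  · have h := groundStateFunctional_nonneg_of_posSemidef (hamiltonianWith G t U μ)
      (posSemidef_totalNumber (Λ := Λ))
    exact (Complex.nonneg_iff.mp h).1
  · have h := groundStateFunctional_nonneg_of_posSemidef (hamiltonianWith G t U μ)
      (posSemidef_two_mul_card_sub_totalNumber (Λ := Λ))
    rw [map_sub, map_smul, groundStateFunctional_one (isHermitian_hamiltonianWith G t U μ)] at h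
    obtain ⟨hre, -⟩ := Complex.nonneg_iff.mp h
    simp only [Complex.sub_re, smul_eq_mul, mul_one, Complex.natCast_re] at hre
    have : (((2 * Fintype.card Λ : ℕ) : ℝ)) = 2 * Fintype.card Λ := by push_cast; ring
    linarith

/-- **`μ ↦ E(μ)` is non-increasing and `2|Λ|`-Lipschitz**: for `μ ≤ μ'`,
`0 ≤ E(μ) - E(μ') ≤ 2|Λ| (μ' - μ)`. [folklore] -/
theorem groundEnergy_sub_mem_Icc_of_le (t U : ℝ) {μ μ' : ℝ} (h : μ ≤ μ') :
    (hamiltonianWith G t U μ).groundEnergy - (hamiltonianWith G t U μ').groundEnergy ∈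
      Set.Icc (0 : ℝ) (2 * Fintype.card Λ * (μ' - μ)) := by
  have h1 := sub_mul_gcNumber_le G t U μ μ'
  have h2 := sub_mul_gcNumber_le G t U μ' μ
  obtain ⟨hn0, -⟩ := gcNumber_mem_Icc G t U μ
  obtain ⟨-, hn2⟩ := gcNumber_mem_Icc G t U μ'
  have hμ : 0 ≤ μ' - μ := sub_nonneg.2 h
  constructor
  · nlinarith
  · nlinarith

/-- **Concavity of `μ ↦ E(μ) = E₀(H(t,U) - μN)`** (a minimum of affine functions of `μ`; here from
the supergradient inequality). [folklore] -/
theorem concaveOn_groundEnergy_hamiltonianWith (t U : ℝ) :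
    ConcaveOn ℝ Set.univ fun μ : ℝ => (hamiltonianWith G t U μ).groundEnergy := by
  refine ⟨convex_univ, fun x _ y _ p q hp hq hpq => ?_⟩
  simp only [smul_eq_mul]
  set z := p * x + q * y with hz
  have hx := mul_le_mul_of_nonneg_left (sub_mul_gcNumber_le G t U z x) hp
  have hy := mul_le_mul_of_nonneg_left (sub_mul_gcNumber_le G t U z y) hq
  have key : p * ((x - z) * ((hamiltonianWith G t U z).groundStateFunctional totalNumber).re) +
      q * ((y - z) * ((hamiltonianWith G t U z).groundStateFunctional totalNumber).re) = 0 := by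
    have hq' : q = 1 - p := by linarith
    rw [hz, hq']
    ring
  have hE : p * (hamiltonianWith G t U z).groundEnergy + q * (hamiltonianWith G t U z).groundEnergy =
      (hamiltonianWith G t U z).groundEnergy := by
    rw [← add_mul, hpq, one_mul]
  nlinarith [hx, hy, key, hE]

/-- The interaction `Σ_x n_{x↑} n_{x↓}` is a positive operator. [folklore] -/
theorem posSemidef_sum_numberOp_mul_numberOp :
    (∑ x : Λ, numberOp x 0 * numberOp x 1 : Matrix (Finset (Orb Λ)) (Finset (Orb Λ)) ℂ).PosSemidef := by
  rw [sum_numberOp_mul_numberOp_eq_diagonal, posSemidef_diagonal_iff]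
  exact fun s => Nat.cast_nonneg _

/-- `Σ_x n_{x↑} n_{x↓} ≤ |Λ|` as operators (at most one doubly occupied pair per site). [folklore] -/
theorem posSemidef_card_sub_sum_numberOp_mul_numberOp :
    (((Fintype.card Λ : ℕ) : ℂ) • (1 : Matrix (Finset (Orb Λ)) (Finset (Orb Λ)) ℂ) -
      ∑ x : Λ, numberOp x 0 * numberOp x 1).PosSemidef := by
  rw [sum_numberOp_mul_numberOp_eq_diagonal, smul_one_eq_diagonal, diagonal_sub,
    posSemidef_diagonal_iff]
  intro s
  exact sub_nonneg.2 (Nat.mono_cast (Finset.card_le_univ (doublyOccupied s)))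

/-- `H(t,U') - μN = (H(t,U) - μN) + (U' - U) Σ_x n_{x↑} n_{x↓}`. [folklore] -/
theorem hamiltonianWith_sub_hamiltonianWith (t U U' μ : ℝ) :
    hamiltonianWith G t U' μ - hamiltonianWith G t U μ =
      ((U' - U : ℝ) : ℂ) • ∑ x : Λ, numberOp x 0 * numberOp x 1 := by
  rw [hamiltonianWith_eq_hoppingForm, hamiltonianWith_eq_hoppingForm, densityTerms_eq,
    densityTerms_eq, Complex.ofReal_sub, sub_smul]
  abel

/-- **The ground energy is non-decreasing in the repulsion**: `U ≤ U' ⇒ E(t,U,μ) ≤ E(t,U',μ)`.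
[folklore] -/
theorem groundEnergy_hamiltonianWith_mono_U (t μ : ℝ) {U U' : ℝ} (h : U ≤ U') :
    (hamiltonianWith G t U μ).groundEnergy ≤ (hamiltonianWith G t U' μ).groundEnergy := by
  refine groundEnergy_mono_of_posSemidef_sub (isHermitian_hamiltonianWith G t U μ)
    (isHermitian_hamiltonianWith G t U' μ) ?_
  rw [hamiltonianWith_sub_hamiltonianWith]
  exact (posSemidef_sum_numberOp_mul_numberOp (Λ := Λ)).smul
    (Complex.zero_le_real.2 (sub_nonneg.2 h))

/-- **… and moves by at most `(U' - U)|Λ|`**: `E(t,U',μ) ≤ E(t,U,μ) + (U' - U)|Λ|` for `U ≤ U'`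
(`0 ≤ Σ_x n_{x↑} n_{x↓} ≤ |Λ|`). In particular `|E(t,U,μ) - E(t,0,μ)| ≤ U|Λ|` for `U ≥ 0`.
[folklore] -/
theorem groundEnergy_hamiltonianWith_le_add (t μ : ℝ) {U U' : ℝ} (h : U ≤ U') :
    (hamiltonianWith G t U' μ).groundEnergy ≤
      (hamiltonianWith G t U μ).groundEnergy + (U' - U) * Fintype.card Λ := by
  refine groundEnergy_le_add_of_sub_le_smul (isHermitian_hamiltonianWith G t U μ)
    (isHermitian_hamiltonianWith G t U' μ) ?_
  rw [hamiltonianWith_sub_hamiltonianWith]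
  have := (posSemidef_card_sub_sum_numberOp_mul_numberOp (Λ := Λ)).smul
    (Complex.zero_le_real.2 (sub_nonneg.2 h))
  convert this using 1
  rw [smul_sub, smul_smul, Complex.ofReal_mul, Complex.ofReal_natCast]

end GrandCanonical

/-! ### Griffiths' lemma and the conditional form of the density clause on the torus -/

section Griffiths

/-- The Griffiths sandwich on the torus `(ℤ/Lℤ)²` (the case `G = fermionTorusGraph 2 L` of
`gcNumber_mem_Icc_slope`, in the `hubbardTorusWith` vocabulary of the crux). [cite: KomaTasaki1994, §1] -/
theorem gcNumber_torus_mem_Icc_slope (L : ℕ) (t U μ : ℝ) {ε : ℝ} (hε : 0 < ε) :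
    ((hubbardTorusWith 2 L t U μ).groundStateFunctional totalNumber).re ∈
      Set.Icc (((hubbardTorusWith 2 L t U (μ - ε)).groundEnergy -
          (hubbardTorusWith 2 L t U μ).groundEnergy) / ε)
        (((hubbardTorusWith 2 L t U μ).groundEnergy -
          (hubbardTorusWith 2 L t U (μ + ε)).groundEnergy) / ε) := by
  have h := gcNumber_mem_Icc_slope (fermionTorusGraph 2 L) t U μ hε
  unfold hubbardTorusWith
  convert h

/-- **Monotonicity of the torus density in `μ`**: `μ ≤ μ' ⇒ Re ω_{L,μ}(N) ≤ Re ω_{L,μ'}(N)` for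
`hubbardTorusWith 2 L t U ·`. [cite: KomaTasaki1994, §1] -/
theorem gcNumber_torus_mono (L : ℕ) (t U : ℝ) {μ μ' : ℝ} (h : μ ≤ μ') :
    ((hubbardTorusWith 2 L t U μ).groundStateFunctional totalNumber).re ≤
      ((hubbardTorusWith 2 L t U μ').groundStateFunctional totalNumber).re := by
  have h' := gcNumber_mono (fermionTorusGraph 2 L) t U h
  unfold hubbardTorusWith
  convert h'

/-- **Griffiths' lemma (sequence form).** Let `f_L : ℝ → ℝ` and numbers `g_L` satisfy the
subgradient sandwich `(f_L(x) - f_L(x-ε))/ε ≤ g_L ≤ (f_L(x+ε) - f_L(x))/ε` for every small `ε > 0`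
and all large `L` (e.g. `f_L` convex with `g_L ∈ ∂f_L(x)`). If `f_L → F` pointwise near `x` and `F`
is differentiable at `x`, then `g_L → F'(x)` (Griffiths, J. Math. Phys. 5 (1964) 1215; Ruelle 1969;
the form in which Koma–Tasaki pass from finite-volume sourced energies to infinite-volume order
parameters). [folklore] -/
theorem tendsto_of_slope_sandwich {f : ℕ → ℝ → ℝ} {g : ℕ → ℝ} {F : ℝ → ℝ} {F' x : ℝ}
    (hsand : ∀ ε : ℝ, 0 < ε → ∀ᶠ L in atTop,
      (f L x - f L (x - ε)) / ε ≤ g L ∧ g L ≤ (f L (x + ε) - f L x) / ε)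
    (hlim : ∀ᶠ y in 𝓝 x, Tendsto (fun L => f L y) atTop (𝓝 (F y)))
    (hF : HasDerivAt F F' x) :
    Tendsto g atTop (𝓝 F') := by
  rw [Metric.tendsto_nhds]
  intro η hη
  have hslope := hasDerivAt_iff_tendsto_slope.1 hF
  rw [Metric.tendsto_nhdsWithin_nhds] at hslope
  obtain ⟨r₁, hr₁, hs⟩ := hslope (η / 2) (half_pos hη)
  obtain ⟨r₂, hr₂, hl⟩ := Metric.eventually_nhds_iff.1 hlim
  set ε := min r₁ r₂ / 2 with hε_def
  have hε : 0 < ε := by positivity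
  have hεr₁ : ε < r₁ := by
    have : min r₁ r₂ ≤ r₁ := min_le_left _ _
    rw [hε_def]; linarith
  have hεr₂ : ε < r₂ := by
    have : min r₁ r₂ ≤ r₂ := min_le_right _ _
    rw [hε_def]; linarith
  have hx : Tendsto (fun L => f L x) atTop (𝓝 (F x)) := hl (by simpa using hr₂)
  have hdp : dist (x + ε) x < r₂ := by
    rw [Real.dist_eq, add_sub_cancel_left, abs_of_pos hε]; exact hεr₂
  have hdm : dist (x - ε) x < r₂ := by
    rw [Real.dist_eq, sub_sub_cancel_left, abs_neg, abs_of_pos hε]; exact hεr₂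
  have hxp : Tendsto (fun L => f L (x + ε)) atTop (𝓝 (F (x + ε))) := hl hdp
  have hxm : Tendsto (fun L => f L (x - ε)) atTop (𝓝 (F (x - ε))) := hl hdm
  have hup : Tendsto (fun L => (f L (x + ε) - f L x) / ε) atTop (𝓝 ((F (x + ε) - F x) / ε)) :=
    (hxp.sub hx).div_const ε
  have hlo : Tendsto (fun L => (f L x - f L (x - ε)) / ε) atTop (𝓝 ((F x - F (x - ε)) / ε)) :=
    (hx.sub hxm).div_const ε
  have hs_up : dist ((F (x + ε) - F x) / ε) F' < η / 2 := by
    have h1 : x + ε ∈ ({x}ᶜ : Set ℝ) := by simp [hε.ne']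
    have h2 : dist (x + ε) x < r₁ := by
      rw [Real.dist_eq, add_sub_cancel_left, abs_of_pos hε]; exact hεr₁
    have := hs h1 h2
    rwa [slope_def_field, add_sub_cancel_left] at this
  have hs_lo : dist ((F x - F (x - ε)) / ε) F' < η / 2 := by
    have h1 : x - ε ∈ ({x}ᶜ : Set ℝ) := by simp [hε.ne']
    have h2 : dist (x - ε) x < r₁ := by
      rw [Real.dist_eq, sub_sub_cancel_left, abs_neg, abs_of_pos hε]; exact hεr₁
    have := hs h1 h2
    rw [slope_def_field, sub_sub_cancel_left] at this
    have h' : (F (x - ε) - F x) / -ε = (F x - F (x - ε)) / ε := by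
      rw [div_neg, ← neg_div, neg_sub]
    rwa [h'] at this
  have e_up := Metric.tendsto_nhds.1 hup (η / 2) (half_pos hη)
  have e_lo := Metric.tendsto_nhds.1 hlo (η / 2) (half_pos hη)
  filter_upwards [e_up, e_lo, hsand ε hε] with L hL1 hL2 hL3
  rw [Real.dist_eq, abs_sub_lt_iff] at hL1 hL2 hs_up hs_lo ⊢
  obtain ⟨h1, h2⟩ := hL3
  constructor <;> linarith [hL1.1, hL1.2, hL2.1, hL2.2, hs_up.1, hs_up.2, hs_lo.1, hs_lo.2]

/-- **Griffiths' lemma for the grand-canonical density of the Hubbard torus (the conditional form of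
the density clause (D)).** Fix `t, U, μ`. IF the ground-state energy density
`E₀(hubbardTorusWith 2 (L+1) t U μ')/(L+1)²` converges, for every `μ'` near `μ`, to a function `e`
differentiable at `μ` with derivative `e'`, THEN the tracial ground-state density
`Re ω_{L,μ}(N)/(L+1)²` converges to `-e'`. (So the registered clause (D) at `(U, δ)` holds as soon as
`1 - δ = -∂_μ e(U, μ)` at a differentiability point `μ` of an existing thermodynamic limit; neither
the limit nor its regularity is in the tree for `d = 2`.) [cite: KomaTasaki1994, §1] -/
theorem tendsto_gcDensity_of_hasDerivAt (t U μ : ℝ) {e : ℝ → ℝ} {e' : ℝ}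
    (hlim : ∀ᶠ μ' in 𝓝 μ, Tendsto (fun L : ℕ =>
      (hubbardTorusWith 2 (L + 1) t U μ').groundEnergy / ((L + 1 : ℕ) : ℝ) ^ 2) atTop (𝓝 (e μ')))
    (hderiv : HasDerivAt e e' μ) :
    Tendsto (fun L : ℕ => ((hubbardTorusWith 2 (L + 1) t U μ).groundStateFunctional
      totalNumber).re / ((L + 1 : ℕ) : ℝ) ^ 2) atTop (𝓝 (-e')) := by
  refine tendsto_of_slope_sandwich
    (f := fun L y => -((hubbardTorusWith 2 (L + 1) t U y).groundEnergy / ((L + 1 : ℕ) : ℝ) ^ 2))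
    (F := fun y => -e y) (x := μ) (fun ε hε => Eventually.of_forall fun L => ?_) ?_ hderiv.neg
  · have hV : (0 : ℝ) < ((L + 1 : ℕ) : ℝ) ^ 2 := by positivity
    obtain ⟨h1, h2⟩ := gcNumber_torus_mem_Icc_slope (L + 1) t U μ hε
    constructor
    · have key : (-((hubbardTorusWith 2 (L + 1) t U μ).groundEnergy / ((L + 1 : ℕ) : ℝ) ^ 2) -
          -((hubbardTorusWith 2 (L + 1) t U (μ - ε)).groundEnergy / ((L + 1 : ℕ) : ℝ) ^ 2)) / ε =
          ((hubbardTorusWith 2 (L + 1) t U (μ - ε)).groundEnergy -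
            (hubbardTorusWith 2 (L + 1) t U μ).groundEnergy) / ε / ((L + 1 : ℕ) : ℝ) ^ 2 := by
        field_simp
        ring
      rw [key]
      exact div_le_div_of_nonneg_right h1 hV.le
    · have key : (-((hubbardTorusWith 2 (L + 1) t U (μ + ε)).groundEnergy / ((L + 1 : ℕ) : ℝ) ^ 2) -
          -((hubbardTorusWith 2 (L + 1) t U μ).groundEnergy / ((L + 1 : ℕ) : ℝ) ^ 2)) / ε =
          ((hubbardTorusWith 2 (L + 1) t U μ).groundEnergy -
            (hubbardTorusWith 2 (L + 1) t U (μ + ε)).groundEnergy) / ε / ((L + 1 : ℕ) : ℝ) ^ 2 := by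
        field_simp
        ring
      rw [key]
      exact div_le_div_of_nonneg_right h2 hV.le
  · filter_upwards [hlim] with y hy
    simpa [neg_div] using hy.neg

/-- **A jump-free density window gives the density clause for EVERY doping in `[a,b]`.** If, at fixed
`t, U`, the ground-state energy density of `hubbardTorusWith 2 (L+1) t U μ'` has a thermodynamic
limit `e(μ')` for every `μ'`, `e` is differentiable on `[μ₁, μ₂]` with derivative `e'`, and the
densities at the two ends bracket the window, `-e'(μ₁) ≤ 1 - b`, `1 - a ≤ -e'(μ₂)`, then for every
`δ ∈ [a,b]` some `μ ∈ [μ₁, μ₂]` has tracial ground-state density tending to `1 - δ` (Darboux's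
intermediate value theorem for `e'`, then Griffiths' lemma). [folklore] -/
theorem exists_tendsto_gcDensity_of_regularWindow (t U : ℝ) {a b μ₁ μ₂ : ℝ} {e e' : ℝ → ℝ}
    (h12 : μ₁ ≤ μ₂)
    (hlim : ∀ μ' : ℝ, Tendsto (fun L : ℕ =>
      (hubbardTorusWith 2 (L + 1) t U μ').groundEnergy / ((L + 1 : ℕ) : ℝ) ^ 2) atTop (𝓝 (e μ')))
    (hder : ∀ μ' ∈ Set.Icc μ₁ μ₂, HasDerivAt e (e' μ') μ')
    (h₁ : -e' μ₁ ≤ 1 - b) (h₂ : 1 - a ≤ -e' μ₂) {δ : ℝ} (hδ : δ ∈ Set.Icc a b) :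
    ∃ μ ∈ Set.Icc μ₁ μ₂, Tendsto (fun L : ℕ => ((hubbardTorusWith 2 (L + 1) t U μ).groundStateFunctional
      totalNumber).re / ((L + 1 : ℕ) : ℝ) ^ 2) atTop (𝓝 (1 - δ)) := by
  have himg : (e' '' Set.Icc μ₁ μ₂).OrdConnected :=
    Set.ordConnected_Icc.image_hasDerivWithinAt fun x hx => (hder x hx).hasDerivWithinAt
  have hmem : δ - 1 ∈ e' '' Set.Icc μ₁ μ₂ :=
    himg.out (Set.mem_image_of_mem _ (Set.right_mem_Icc.2 h12))
      (Set.mem_image_of_mem _ (Set.left_mem_Icc.2 h12)) ⟨by linarith [hδ.1], by linarith [hδ.2]⟩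
  obtain ⟨μ, hμ, hμeq⟩ := hmem
  refine ⟨μ, hμ, ?_⟩
  have := tendsto_gcDensity_of_hasDerivAt t U μ (Eventually.of_forall hlim) (hder μ hμ)
  rwa [hμeq, neg_sub] at this

/-- **The density clause of crux `WcbcsBcsConstruction`, conditionally.** IF for every doping window
`[a,b] ⊂ (0,1/2)` there is a weak-coupling window `(0,U₁)` on which the grand-canonical ground-state
energy density of `hubbardTorusWith 2 (L+1) 1 U ·` has a thermodynamic limit `e(U,·)` that is
differentiable across a chemical-potential interval whose end densities bracket `[1-b, 1-a]`
(no first-order density jump sweeps the window — the open part of the `h = 0` equation of state at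
weak coupling), THEN `∀ [a,b] ∃ δ ∈ [a,b] ∃ U₁ > 0 ∀ U ∈ (0,U₁) ∃ μ, n_{L+1}(U,μ) → 1 - δ` (in fact for every
`δ ∈ [a,b]`; we exhibit `δ = a`). The conclusion is, verbatim, the registered stub `stub_densityWindow` of the
line `lro-seed-kink-bridge` of that crux (stmt-HubbardSuperconductivity-2010). [folklore] -/
theorem densityClause_of_regularWindows
    (hreg : ∀ a b : ℝ, 0 < a → a < b → b < 1 / 2 → ∃ U₁ : ℝ, 0 < U₁ ∧ ∀ U ∈ Set.Ioo (0:ℝ) U₁,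
      ∃ (e e' : ℝ → ℝ) (μ₁ μ₂ : ℝ), μ₁ ≤ μ₂ ∧
        (∀ μ' : ℝ, Tendsto (fun L : ℕ => (hubbardTorusWith 2 (L + 1) 1 U μ').groundEnergy /
          ((L + 1 : ℕ) : ℝ) ^ 2) atTop (𝓝 (e μ'))) ∧
        (∀ μ' ∈ Set.Icc μ₁ μ₂, HasDerivAt e (e' μ') μ') ∧ -e' μ₁ ≤ 1 - b ∧ 1 - a ≤ -e' μ₂) :
    ∀ a b : ℝ, 0 < a → a < b → b < 1 / 2 → ∃ δ ∈ Set.Icc a b, ∃ U₁ : ℝ, 0 < U₁ ∧ ∀ U ∈ Set.Ioo (0:ℝ) U₁,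
      ∃ μ : ℝ, Filter.Tendsto (fun L : ℕ => ((hubbardTorusWith 2 (L + 1) 1 U μ).groundStateFunctional
        totalNumber).re / ((L + 1 : ℕ) : ℝ) ^ 2) Filter.atTop (nhds (1 - δ)) := by
  intro a b ha hab hb
  obtain ⟨U₁, hU₁, hwin⟩ := hreg a b ha hab hb
  refine ⟨a, ⟨le_rfl, hab.le⟩, U₁, hU₁, fun U hU => ?_⟩
  obtain ⟨e, e', μ₁, μ₂, h12, hlim, hder, h₁, h₂⟩ := hwin U hU
  obtain ⟨μ, -, hμ⟩ := exists_tendsto_gcDensity_of_regularWindow 1 U h12 hlim hder h₁ h₂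
    (δ := a) ⟨le_rfl, hab.le⟩
  exact ⟨μ, hμ⟩

end Griffiths

/-! ### Finite-volume corollaries on the torus `(ℤ/Lℤ)²`, in the normalisation of the crux -/

section Torus

/-- **The torus density per site lies in `[0, 2]`**: `0 ≤ Re ω_{L,μ}(N)/L² ≤ 2` (`L ≠ 0`). [folklore] -/
theorem gcDensity_torus_mem_Icc (L : ℕ) [NeZero L] (t U μ : ℝ) :
    ((hubbardTorusWith 2 L t U μ).groundStateFunctional totalNumber).re / (L : ℝ) ^ 2 ∈
      Set.Icc (0 : ℝ) 2 := by
  have h := gcNumber_mem_Icc (fermionTorusGraph 2 L) t U μ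
  rw [card_fermionTorus 2] at h
  have h' : ((hubbardTorusWith 2 L t U μ).groundStateFunctional totalNumber).re ∈
      Set.Icc (0 : ℝ) (2 * (L ^ 2 : ℕ)) := by
    unfold hubbardTorusWith
    convert h
  push_cast at h'
  have hL := cast_sq_pos_of_neZero L
  exact ⟨div_nonneg h'.1 hL.le, (div_le_iff₀ hL).2 h'.2⟩

/-- **`μ ↦ E₀(hubbardTorusWith 2 L t U μ)` is non-increasing and `2L²`-Lipschitz**: for `μ ≤ μ'`,
`0 ≤ E(μ) - E(μ') ≤ 2L²(μ' - μ)`. [folklore] -/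
theorem groundEnergy_torus_sub_mem_Icc_of_le (L : ℕ) (t U : ℝ) {μ μ' : ℝ} (h : μ ≤ μ') :
    (hubbardTorusWith 2 L t U μ).groundEnergy - (hubbardTorusWith 2 L t U μ').groundEnergy ∈
      Set.Icc (0 : ℝ) (2 * (L : ℝ) ^ 2 * (μ' - μ)) := by
  have h' := groundEnergy_sub_mem_Icc_of_le (fermionTorusGraph 2 L) t U h
  rw [card_fermionTorus 2] at h'
  push_cast at h'
  unfold hubbardTorusWith
  convert h'

/-- **Concavity of `μ ↦ E₀(hubbardTorusWith 2 L t U μ)`.** [folklore] -/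
theorem concaveOn_groundEnergy_hubbardTorusWith (L : ℕ) (t U : ℝ) :
    ConcaveOn ℝ Set.univ fun μ : ℝ => (hubbardTorusWith 2 L t U μ).groundEnergy := by
  have h := concaveOn_groundEnergy_hamiltonianWith (fermionTorusGraph 2 L) t U
  unfold hubbardTorusWith
  convert h

/-- **The interaction sandwich on the torus**: for `0 ≤ U`,
`E₀(hubbardTorusWith 2 L t 0 μ) ≤ E₀(hubbardTorusWith 2 L t U μ) ≤ E₀(hubbardTorusWith 2 L t 0 μ) + U L²`
(so the interacting and free ground-state energy DENSITIES differ by at most `U`, uniformly in `L`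
and `μ`). [folklore] -/
theorem groundEnergy_torus_sub_free_mem_Icc (L : ℕ) (t μ : ℝ) {U : ℝ} (hU : 0 ≤ U) :
    (hubbardTorusWith 2 L t U μ).groundEnergy - (hubbardTorusWith 2 L t 0 μ).groundEnergy ∈
      Set.Icc (0 : ℝ) (U * (L : ℝ) ^ 2) := by
  have h1 := groundEnergy_hamiltonianWith_mono_U (fermionTorusGraph 2 L) t μ hU
  have h2 := groundEnergy_hamiltonianWith_le_add (fermionTorusGraph 2 L) t μ hU
  rw [card_fermionTorus 2, sub_zero] at h2
  push_cast at h2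
  have h1' : (hubbardTorusWith 2 L t 0 μ).groundEnergy ≤ (hubbardTorusWith 2 L t U μ).groundEnergy := by
    unfold hubbardTorusWith
    convert h1
  have h2' : (hubbardTorusWith 2 L t U μ).groundEnergy ≤
      (hubbardTorusWith 2 L t 0 μ).groundEnergy + U * (L : ℝ) ^ 2 := by
    unfold hubbardTorusWith
    convert h2
  exact ⟨sub_nonneg.2 h1', by linarith⟩

end Torus

end Literature.MathematicalPhysics.QuantumLattice

end
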